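import Summits.QuantumFields.BalabanUV.Beta.D1BFx.TwoBondWardPairing
import Summits.QuantumFields.BalabanUV.Beta.D1BFx.PackedColumnEnvelope

/-!
# `BalabanUV.Beta.D1BFx.TwoBondWardPairingRoad` — road «BF-x» for binder row D1, slot (K), junction (J3), brick (B2) second half, GENERIC CORE 1′:
# **AT THE ROAD's WEIGHTS** — for ANY two-bond scalar table `H κ l u u′` that decays off the diagonal and whose rows are divergence-free in each bond
# (the fine Ward rows), the two-slot pairing with the road's CO-DRESSED ℋ-columns `colH G₀ (m+1)` equals the pairing with the UNDRESSED columns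
# `colH K₀ (m+1)` (`G₀ = coDressKBmAt (toSite r) (m+1) (KInvStep (m+1) 0)`, any in-block root `r`): `TwoBondWardPairing.pairing_grad_shift_invariant`
# with its letters discharged by gan24-leaf-05's «G0-COL-ENV» (`PackedColumnEnvelope`) and `colH_coDressKBmAt_eq_sub_grad` ∕ `abs_bmGaugeAt_le`
# (`GAN24.CoDressedColumnPairing`).  The ghost instance is `GhostWardTransversal`; this file is table-generic on purpose (a re-cut (A1) member may
# transcribe the second-order table differently — road owner d1-p2 g20 W-1).

HONEST DEPENDENCY (cell records, verbatim): «continuum YM on T⁴ ⇐ BetaPertH ∧ nine spine estimates (0/9 proved); BetaPertH ⇐ (D1) ∧ (D4) ∧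
CAP+tail; G-an2-4 gates asym, D1 and NE2/3/4.»  HONEST FRAMING (cell contract, verbatim): «discharging `BetaPertH` makes Bałaban's UV stability
UNCONDITIONAL — a real constructive-QFT result; it is NOT the continuum limit and NOT the Clay problem.»  THIS MODULE DISCHARGES NOTHING of the
wall: [folklore] `tsum` bookkeeping + composition BY NAME; hypotheses only; nothing of Bałaban's asserted; no definition, no `def … : Prop`, no
notation, nothing cited, 0 sorry.  0 root-level binders of row D1 discharged (hW ∕ hR-sockets ∕ hSX-socket ∕ D1Tel ∕ D1Rep — 0); (J3) DISPLAYED;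
(K) NOT closed; NOT D1, NOT `BetaPertH`, NOT continuum, NOT Clay.

ABSOLUTE RULE (cell charter, verbatim): «No internally-minted statement may enter as a cited fact. Every hypothesis is either kernel-proved in
this package or a verbatim quotation of a PUBLISHED theorem with page reference. The manuscript(s) under audit are NOT citable for their own
disputed steps — they are the thing under adjudication; programme-internal (2001/route/tribunal) claims are never citable.»

Unit `b2b-balaban-beta-d1-formalise-leaf-04` (gen 21), D1 formalisation swarm leaf prover 04, road «BF-x»; (B2) second half per R-D1-g40-1 ∕ ρ-g19-4 ∕ W-1 (g20) (journal).
-/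

noncomputable section

open Finset
open scoped BigOperators
open Literature.MathematicalPhysics.QuantumFieldTheory
open Literature.MathematicalPhysics.QuantumFieldTheory.Balaban1983to89
open Literature.MathematicalPhysics.QuantumFieldTheory.Balaban1983to89.Beta
open B12Sec2to5 (l1 l1_nonneg)
open B5Hk163Strip (kappa163 kappa163_pos)
open B5Hk163Decay (MG163)
open B4TorusKernel (periodConst)
open ExpKernelCalculus (Site MKer Zl Zl_pos summable_exp_shift summable_exp_shift' tsum_exp_shift tsum_exp_shift' l1_sub_triangle l1_sub_symm)
open AffineAveraging (Form0 Form1 box toSite unitVec)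
open OneStepKernelFamily (KInvStep colH)
open Summit.QuantumFields.BalabanUV.Beta.AxialProjectorBlockMean (bmGaugeAt)
open Summit.QuantumFields.BalabanUV.Beta.AxialDressingRooted (coDressKBmAt)
open Summit.QuantumFields.BalabanUV.Beta.GAN24.CoDressedColumnPairing (colH_coDressKBmAt_eq_sub_grad abs_bmGaugeAt_le)
open B5Kernel166Decay (periodConst_pos)
open B4ContourShift (supNorm supNorm_nonneg)
open Literature.MathematicalPhysics.QuantumFieldTheory.LatticeForm (quo)
open Summit.QuantumFields.BalabanUV.Beta.D1BFx.PackedColumnEnvelope (abs_colH_KInvStep_zero_le abs_colH_G₀_road_le colH_G₀_road_weight_nonneg)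
open Summit.QuantumFields.BalabanUV.Beta.D1BFx.TwoBondWardPairing (summable_bdd_mul pairing_grad_shift_invariant)

namespace Summit.QuantumFields.BalabanUV.Beta.D1BFx.TwoBondWardPairingRoad

/-! ## §1 The road's weights: bounded ℋ-columns and their bounded block-mean tree gauge (block size `n`) -/

section Weights

variable (n : ℕ) [NeZero n]

/-- [folklore] The undressed ℋ-column weights are bounded: `|colH K₀ n μ y κ u| ≤ MG163 4·periodConst (kappa163 4) 3` (`abs_colH_KInvStep_zero_le`,
dropping `n⁻⁵ ≤ 1` and the exponential). -/
theorem abs_colH_K₀_le (μ : Fin 4) (y : Site 4) (κ : Fin 4) (u : Site 4) :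
    |colH (KInvStep (d := 3) n 0) n μ y κ u| ≤ MG163 (3 + 1) * periodConst (kappa163 (3 + 1)) 3 := by
  have hn1 : 1 ≤ n := NeZero.one_le
  have h := abs_colH_KInvStep_zero_le (d := 3) (N := n) hn1 μ y κ u
  refine h.trans ?_
  have hA : ((n : ℝ) ^ (3 + 2))⁻¹ ≤ 1 := inv_le_one_of_one_le₀ (one_le_pow₀ (by exact_mod_cast hn1))
  have hA0 : 0 ≤ ((n : ℝ) ^ (3 + 2))⁻¹ := by positivity
  have hM : 0 ≤ MG163 (3 + 1) * periodConst (kappa163 (3 + 1)) 3 :=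
    mul_nonneg (B5Hk163Decay.MG163_nonneg _) (periodConst_pos (kappa163_pos _) 3).le
  calc ((n : ℝ) ^ (3 + 2))⁻¹ * (MG163 (3 + 1) * periodConst (kappa163 (3 + 1)) 3)
        * Real.exp (-(kappa163 (3 + 1) / ((3 : ℕ) + 1 : ℝ) * supNorm (quo n u - y)))
      ≤ ((n : ℝ) ^ (3 + 2))⁻¹ * (MG163 (3 + 1) * periodConst (kappa163 (3 + 1)) 3) := by
        refine mul_le_of_le_one_right (mul_nonneg hA0 hM) ?_
        rw [Real.exp_le_one_iff, neg_nonpos]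
        exact mul_nonneg (div_nonneg (kappa163_pos _).le (by positivity)) (supNorm_nonneg _)
    _ ≤ 1 * (MG163 (3 + 1) * periodConst (kappa163 (3 + 1)) 3) := mul_le_mul_of_nonneg_right hA hM
    _ = MG163 (3 + 1) * periodConst (kappa163 (3 + 1)) 3 := one_mul _

/-- [folklore] The block-mean tree gauge of an ℋ-column is bounded (gan24-leaf-05's `abs_bmGaugeAt_le` at §3's bound): `|χ_{μ,y}(u)| ≤ 2·(4·n·M_K)`. -/
theorem abs_bmGaugeAt_colH_K₀_le {r : Fin 4 → ℕ} (hr : r ∈ box 4 n) (μ : Fin 4) (y u : Site 4) :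
    |bmGaugeAt (toSite r) (colH (KInvStep (d := 3) n 0) n μ y) n u|
      ≤ 2 * ((((3 + 1 : ℕ) : ℝ)) * n * (MG163 (3 + 1) * periodConst (kappa163 (3 + 1)) 3)) :=
  abs_bmGaugeAt_le (d := 3) NeZero.one_le hr (fun κ w => abs_colH_K₀_le n μ y κ w) u

end Weights

/-! ## §2 Rows and the `colH G₀`-contraction of a decaying two-bond table (block size `m + 1`) -/

/-- [folklore] **SUMMABLE ROWS** of a table decaying off the diagonal. -/
theorem summable_row_of_decay {H : Fin 4 → Fin 4 → Site 4 → Site 4 → ℝ} {C δ : ℝ} (hδ : 0 < δ)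
    (hH : ∀ (κ l : Fin 4) (u u' : Site 4), |H κ l u u'| ≤ C * Real.exp (-δ * l1 (u - u'))) (κ l : Fin 4) (u : Site 4) :
    Summable fun u' : Site 4 => H κ l u u' :=
  Summable.of_norm_bounded ((summable_exp_shift hδ u).mul_left C) fun u' => by rw [Real.norm_eq_abs]; exact hH κ l u u'

section Contraction

variable (m : ℕ) {r : Fin (3 + 1) → ℕ} (hr : r ∈ box (3 + 1) (m + 1)) {H : Fin 4 → Fin 4 → Site 4 → Site 4 → ℝ} {C δ : ℝ} (hδ : 0 < δ)
  (hH : ∀ (κ l : Fin 4) (u u' : Site 4), |H κ l u u'| ≤ C * Real.exp (-δ * l1 (u - u')))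
include hr hδ hH

/-- [folklore] **THE CO-DRESSED SECOND-SLOT CONTRACTION IS SUMMABLE IN THE FIRST BASE POINT**: with «G0-COL-ENV»
(`abs_colH_G₀_road_le`: `|colH G₀ (m+1) ν y′ l u′| ≤ W·e^{−c_r|u′ − (m+1)•y′|₁}`) and an off-diagonal decaying table `H`, the one-form
`u ↦ Σ_l Σ'_{u′} colH G₀ (m+1) ν y′ l u′ · H κ l u u′` is bounded by a multiple of `e^{−θ|u − (m+1)•y′|₁}`, hence summable. -/
theorem summable_contraction_G₀ (ν : Fin 4) (y' : Site 4) (κ : Fin 4) :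
    Summable fun u : Site 4 => ∑ l : Fin 4, ∑' u' : Site 4,
      colH (coDressKBmAt (toSite r) (m + 1) (KInvStep (d := 3) (m + 1) 0)) (m + 1) ν y' l u'
        * H κ l u u' := by
  set W : ℝ := ((((m + 1 : ℕ) : ℝ) ^ 4)⁻¹ * ((MG163 4 * periodConst (kappa163 4) 3)
          * (1 + 8 * (1 + Real.exp (kappa163 4 / 4))) * Real.exp (kappa163 4 / 4))) with hW
  set cr : ℝ := kappa163 4 / 4 / (4 * ((m + 1 : ℕ) : ℝ)) with hcr
  set p : Site 4 := ((m + 1 : ℕ) : ℤ) • y' with hp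
  have hW0 : 0 ≤ W := colH_G₀_road_weight_nonneg m
  have hcr0 : 0 < cr := by
    have := kappa163_pos 4
    have : (0 : ℝ) < ((m + 1 : ℕ) : ℝ) := by exact_mod_cast Nat.succ_pos m
    positivity
  have hC0 : 0 ≤ C := by
    have h0 := (abs_nonneg _).trans (hH 0 0 0 0)
    rw [sub_self, show l1 (0 : Site 4) = 0 by simp [l1], mul_zero, Real.exp_zero, mul_one] at h0
    exact h0
  set θ : ℝ := min cr δ with hθ
  have hθ0 : 0 < θ := lt_min hcr0 hδ
  have hθcr : θ ≤ cr := min_le_left _ _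
  have hθδ : θ ≤ δ := min_le_right _ _
  have hw : ∀ l u', |colH (coDressKBmAt (toSite r) (m + 1) (KInvStep (d := 3) (m + 1) 0)) (m + 1) ν y' l u'|
      ≤ W * Real.exp (-cr * l1 (u' - p)) := fun l u' => by
    have h := abs_colH_G₀_road_le m hr ν y' l u'
    rw [hW, hcr, hp]
    convert h using 2
  -- the pointwise majorant of one term, split along the triangle inequality
  have hterm : ∀ (l : Fin 4) (u u' : Site 4),
      |colH (coDressKBmAt (toSite r) (m + 1) (KInvStep (d := 3) (m + 1) 0)) (m + 1) ν y' l u'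
        * H κ l u u'|
        ≤ W * C * Real.exp (-(θ / 2) * l1 (u - p)) * Real.exp (-(θ / 2) * l1 (u' - p)) := by
    intro l u u'
    rw [abs_mul]
    have h1 := hw l u'
    have h2 := hH κ l u u'
    have htri : l1 (u - p) ≤ l1 (u - u') + l1 (u' - p) := l1_sub_triangle u u' p
    have hl1 : 0 ≤ l1 (u - u') := l1_nonneg _
    have hl2 : 0 ≤ l1 (u' - p) := l1_nonneg _
    have hexp : Real.exp (-cr * l1 (u' - p)) * Real.exp (-δ * l1 (u - u'))
        ≤ Real.exp (-(θ / 2) * l1 (u - p)) * Real.exp (-(θ / 2) * l1 (u' - p)) := by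
      rw [← Real.exp_add, ← Real.exp_add, Real.exp_le_exp]
      nlinarith [hθ0.le]
    calc |colH _ (m + 1) ν y' l u'| * |H κ l u u'|
        ≤ (W * Real.exp (-cr * l1 (u' - p))) * (C * Real.exp (-δ * l1 (u - u'))) :=
          mul_le_mul h1 h2 (abs_nonneg _) (by positivity)
      _ = W * C * (Real.exp (-cr * l1 (u' - p)) * Real.exp (-δ * l1 (u - u'))) := by ring
      _ ≤ W * C * (Real.exp (-(θ / 2) * l1 (u - p)) * Real.exp (-(θ / 2) * l1 (u' - p))) :=
          mul_le_mul_of_nonneg_left hexp (mul_nonneg hW0 hC0)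
      _ = _ := by ring
  -- the row sums against the majorant
  have hmaj : ∀ u : Site 4, Summable fun u' : Site 4 => W * C * Real.exp (-(θ / 2) * l1 (u - p)) * Real.exp (-(θ / 2) * l1 (u' - p)) :=
    fun u => (summable_exp_shift' (half_pos hθ0) p).mul_left _
  have hrow : ∀ (l : Fin 4) (u : Site 4), Summable fun u' : Site 4 =>
      colH (coDressKBmAt (toSite r) (m + 1) (KInvStep (d := 3) (m + 1) 0)) (m + 1) ν y' l u'
        * H κ l u u' := fun l u =>
    Summable.of_norm_bounded (hmaj u) fun u' => by rw [Real.norm_eq_abs]; exact hterm l u u'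
  have hbound : ∀ u : Site 4, |∑ l : Fin 4, ∑' u' : Site 4,
      colH (coDressKBmAt (toSite r) (m + 1) (KInvStep (d := 3) (m + 1) 0)) (m + 1) ν y' l u'
        * H κ l u u'|
      ≤ 4 * (W * C * Zl 4 (θ / 2)) * Real.exp (-(θ / 2) * l1 (u - p)) := by
    intro u
    have hsum : ∀ l : Fin 4, |∑' u' : Site 4,
        colH (coDressKBmAt (toSite r) (m + 1) (KInvStep (d := 3) (m + 1) 0)) (m + 1) ν y' l u'
          * H κ l u u'|
        ≤ W * C * Zl 4 (θ / 2) * Real.exp (-(θ / 2) * l1 (u - p)) := by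
      intro l
      calc |∑' u' : Site 4, _| ≤ ∑' u' : Site 4, |colH (coDressKBmAt (toSite r) (m + 1) (KInvStep (d := 3) (m + 1) 0)) (m + 1) ν y' l u'
              * H κ l u u'| :=
            norm_tsum_le_tsum_norm (hrow l u).norm
        _ ≤ ∑' u' : Site 4, W * C * Real.exp (-(θ / 2) * l1 (u - p)) * Real.exp (-(θ / 2) * l1 (u' - p)) :=
            Summable.tsum_le_tsum (fun u' => hterm l u u') (hrow l u).abs (hmaj u)
        _ = W * C * Zl 4 (θ / 2) * Real.exp (-(θ / 2) * l1 (u - p)) := by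
            rw [tsum_mul_left, tsum_exp_shift']; ring
    calc |∑ l : Fin 4, _| ≤ ∑ l : Fin 4, |∑' u' : Site 4, _| := Finset.abs_sum_le_sum_abs _ _
      _ ≤ ∑ _l : Fin 4, W * C * Zl 4 (θ / 2) * Real.exp (-(θ / 2) * l1 (u - p)) := Finset.sum_le_sum fun l _ => hsum l
      _ = 4 * (W * C * Zl 4 (θ / 2)) * Real.exp (-(θ / 2) * l1 (u - p)) := by
          rw [Finset.sum_const, Finset.card_univ, Fintype.card_fin, nsmul_eq_mul]; push_cast; ring
  exact Summable.of_norm_bounded ((summable_exp_shift' (half_pos hθ0) p).mul_left (4 * (W * C * Zl 4 (θ / 2))))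
    fun u => by rw [Real.norm_eq_abs]; exact hbound u

end Contraction

/-! ## §3 The dressed pairing equals the undressed one -/

section Main

variable (m : ℕ) {r : Fin (3 + 1) → ℕ} (hr : r ∈ box (3 + 1) (m + 1)) {H : Fin 4 → Fin 4 → Site 4 → Site 4 → ℝ} {C δ : ℝ} (hδ : 0 < δ)
  (hH : ∀ (κ l : Fin 4) (u u' : Site 4), |H κ l u u'| ≤ C * Real.exp (-δ * l1 (u - u')))
  (hdiv₁ : ∀ (l : Fin 4) (u' u : Site 4), ∑ κ : Fin 4, (H κ l u u' - H κ l (u - unitVec κ) u') = 0)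
  (hdiv₂ : ∀ (κ : Fin 4) (u u' : Site 4), ∑ l : Fin 4, (H κ l u u' - H κ l u (u' - unitVec l)) = 0)
include hr hδ hH hdiv₁ hdiv₂

/-- [folklore] **THE ROAD's CO-DRESSING IS INVISIBLE ON THE TWO-SLOT PAIRING WITH ANY WARD-TRANSVERSAL TABLE**: for a two-bond scalar table
`H` decaying off the diagonal (`hH`) whose rows are divergence-free in EACH bond (`hdiv₁`, `hdiv₂` — the fine Ward rows), and the road's two weight
families — the undressed ℋ-columns `colH K₀ (m+1)` and their block-mean axial co-dressing `colH G₀ (m+1)`, `G₀ = coDressKBmAt (toSite r) (m+1) K₀`,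
`K₀ = KInvStep (m+1) 0`, ANY in-block root `r` —
`Σ_κ Σ'_u colH G₀ μ y κ u · Σ_l Σ'_{u′} colH G₀ ν y′ l u′ · H κ l u u′ = Σ_κ Σ'_u colH K₀ μ y κ u · Σ_l Σ'_{u′} colH K₀ ν y′ l u′ · H κ l u u′`
(`TwoBondWardPairing.pairing_grad_shift_invariant` at §1–§2 with gan24-leaf-05's `colH_coDressKBmAt_eq_sub_grad`: `colH G₀ = colH K₀ − grad (bmGaugeAt ρ (colH K₀) n)`). -/
theorem road_pairing_dressed_eq_undressed (μ : Fin 4) (y : Site 4) (ν : Fin 4) (y' : Site 4) :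
    ∑ κ : Fin 4, ∑' u : Site 4, colH (coDressKBmAt (toSite r) (m + 1) (KInvStep (d := 3) (m + 1) 0)) (m + 1) μ y κ u
        * ∑ l : Fin 4, ∑' u' : Site 4, colH (coDressKBmAt (toSite r) (m + 1) (KInvStep (d := 3) (m + 1) 0)) (m + 1) ν y' l u'
            * H κ l u u'
      = ∑ κ : Fin 4, ∑' u : Site 4, colH (KInvStep (d := 3) (m + 1) 0) (m + 1) μ y κ u
          * ∑ l : Fin 4, ∑' u' : Site 4, colH (KInvStep (d := 3) (m + 1) 0) (m + 1) ν y' l u'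
              * H κ l u u' := by
  have hN : 1 ≤ m + 1 := Nat.succ_le_succ (Nat.zero_le m)
  have hG := summable_contraction_G₀ m hr hδ hH ν y'
  have e : ∀ (μ : Fin 4) (y : Site 4) (κ : Fin 4) (u : Site 4),
      colH (coDressKBmAt (toSite r) (m + 1) (KInvStep (d := 3) (m + 1) 0)) (m + 1) μ y κ u
        = colH (KInvStep (d := 3) (m + 1) 0) (m + 1) μ y κ u
          - (bmGaugeAt (toSite r) (colH (KInvStep (d := 3) (m + 1) 0) (m + 1) μ y) (m + 1) (u + unitVec κ)
              - bmGaugeAt (toSite r) (colH (KInvStep (d := 3) (m + 1) 0) (m + 1) μ y) (m + 1) u) :=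
    fun μ y κ u => colH_coDressKBmAt_eq_sub_grad hN hr _ μ y κ u
  simp_rw [e] at hG ⊢
  exact pairing_grad_shift_invariant
    (H)
    (w₁ := colH (KInvStep (d := 3) (m + 1) 0) (m + 1) μ y) (w₂ := colH (KInvStep (d := 3) (m + 1) 0) (m + 1) ν y')
    (χ₁ := bmGaugeAt (toSite r) (colH (KInvStep (d := 3) (m + 1) 0) (m + 1) μ y) (m + 1))
    (χ₂ := bmGaugeAt (toSite r) (colH (KInvStep (d := 3) (m + 1) 0) (m + 1) ν y') (m + 1))
    (fun κ u => abs_colH_K₀_le (m + 1) μ y κ u) (fun l u' => abs_colH_K₀_le (m + 1) ν y' l u')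
    (fun u => abs_bmGaugeAt_colH_K₀_le (m + 1) hr μ y u) (fun u' => abs_bmGaugeAt_colH_K₀_le (m + 1) hr ν y' u')
    (fun κ l u => summable_row_of_decay hδ hH κ l u) hdiv₁ hdiv₂ (fun κ => hG κ)

end Main

end Summit.QuantumFields.BalabanUV.Beta.D1BFx.TwoBondWardPairingRoad

end
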